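import Summits.CriticalPhenomena.PercolationContinuityZ3.Theorems.Transplant.SkelPhiFaceRouteInputs4YF
import Summits.CriticalPhenomena.PercolationContinuityZ3.Theorems.Transplant.SkelPhiFaceRouteNumbersY6
import Summits.CriticalPhenomena.PercolationContinuityZ3.Theorems.Transplant.SkelPhiParaRunClear
import Summits.CriticalPhenomena.PercolationContinuityZ3.Theorems.Transplant.SkelPhiParaRunCross
import Summits.CriticalPhenomena.PercolationContinuityZ3.Theorems.Transplant.SkelNegBParamsFoot
import Summits.CriticalPhenomena.PercolationContinuityZ3.Theorems.Transplant.SkelPhiFaceRouteReadings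
import Summits.CriticalPhenomena.PercolationContinuityZ3.Theorems.Transplant.SkelPhiNegReachRoomsRun
import Summits.CriticalPhenomena.PercolationContinuityZ3.Theorems.Transplant.SkelPhiRootNumbersY
import HarnessLib

/-!
# N2 (frames-only node), (S0) kit tier, (F) spine (hp-8 g39): **`faceRoute_of_numbers7_yF`** — the (S0) twin of `faceRoute_of_numbers7_y` (N1, (F) inner
# route part R4b v7, hp-8 g35/g36): the route datum of a face-step kit at an y′-FACE with the footprint / clearance / cross-link ROOMS of
# `faceRoute_of_inputs4_yF` DISCHARGED from per-centre NUMBERS (the along run's numbers `NrY`, the tangential run's `N3Y`, served signs, the foot box,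
# the target window) — the geometry is N1's VERBATIM (same frames, same schedules, same rooms); only the kit tier underneath is (S0): kit-constant binders
# per p1-g16's forced clauses, generic short region `Rg` + zone datum rows (`hΛRg/hzconn/hcz/hkz/hRkb/hRkr/hΛcyl`), Step-I‴ inputs at accuracy `δ³` without
# zone/exit estimates, `hchain` over `KitsAtF`.

builds on p205010 (kernel theorem, internal audit signed; external expert review pending) — nothing in this file uses p205010; nothing here is a
claim about the open node `SamePDropOfSkeletonFrm₁`.
Lane `prim-bschramm`, seat `prim-hp-8` (gen 39); helper file (`--supports stmt-CriticalPhenomena-4575 --as helper`); F-PORT-JUNCTIONS (hp-8 g37).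
* **`Skelφ.faceRoute_of_numbers7_yF`** (proof body = N1's, final call ↦ `faceRoute_of_inputs4_yF`).
[cite: KozmaNitzan2024, §4 Lemma 10 (pp. 17–21), Lemma 11 (pp. 22–23), Lemma 12 (pp. 23–25), p. 30 (Step III)] [cite: MartineauTassion2017, §4.3 Lemma 4.2]
-/


noncomputable section

open MeasureTheory ProbabilityTheory
open scoped ENNReal Classical

namespace Summit.CriticalPhenomena.PercolationContinuityZ3.Theorems.Transplant

namespace Skelφ

open Literature.Probability.Percolation Literature.Probability.LatticeModels SimpleGraph GadgetSystem Contour KNCells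
open Literature.Probability.Percolation.KozmaNitzan.Cells (oth sgOf stepVec_apply_fst)
open KNLevels ChainPlanar ChainPara
open Literature.Barriers.CriticalPhenomena (graphBall mem_graphBall_self graphBall_mono)
open BoxProdZ2 (ConcRadiiG)
open Skel (winGraph routeW excess)
open SkelI (tanOff)
open TwoAxis.Para (modulus)

-- §1 (the served seed clearances `clear_alongY_of_floors`, `clear_tanX_of_level`) is p1-g13's, in `SkelPhiFaceRouteNumbersY6` (p314991), imported.

/-! ## §2 The route datum -/

variable {V : Type} [DecidableEq V] {G : SimpleGraph V} [G.LocallyFinite] {φ ψc : V → Site 2}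

/-- **THE ROUTE DATUM OF A FACE-STEP KIT AT A y′-FACE FROM THE INPUTS AND NUMBERS, TWO SIGNS** (hop side `σ_h`, run sign `σ`; see the module
docstring; one planar map `φ` for kit, bridge and runs). [cite: KozmaNitzan2024, §4 Lemma 10 (pp. 17–21), Lemma 11 (pp. 22–23), Lemma 12 (pp. 23–25)] -/
theorem faceRoute_of_numbers7_yF [Countable V] {types : Finset V} (hlipφ : Lip G φ) (hstep : Steps G φ) (hfr : Frames G φ types) (hκ : CylConn G φ types)
    {Δg : ℕ} (hΔg : ∀ v, G.degree v ≤ Δg)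
    {w₀ c : V} {Rπ L : ℕ} {Wt : Sym2 V → unitInterval} {q : unitInterval} {D T Z : Finset V}
    (hWG : ∀ e, e ∉ G.edgeSet → Wt e = 0) (hWD : IsSubbox (winGraph G w₀ Rπ) Wt q D) (hDπ : ∀ u ∈ D, u ∈ graphBall G w₀ Rπ)
    (hcL : c ∈ graphBall G w₀ (Rπ - L)) (hLπ : L ≤ Rπ)
    {Pl : Finset (Site 2)} {MM : Finset V} (hPlD : Win G ψc w₀ Pl Rπ ⊆ D) (hMT : MM ⊆ T) (hMZ : Disjoint MM Z) (du : MDir) {σh σ : ℤ} (hσh : σh = 1 ∨ σh = -1) (hσ : σ = 1 ∨ σ = -1)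
    {Af vα vβ c0f c1f Df : ℤ} (hAf : 0 ≤ Af) {nL : ℕ} (hnL : 1 ≤ nL) (hL : ℤ) (hmf : 0 ≤ modulus nL hL vα vβ) (hc0 : 0 ≤ c0f) (hc1 : 0 ≤ c1f)
    (hDf : 0 < Df) {flo fhi fw : ℤ} {LLO LHI : Site 2}
    (hPlfoot : ∀ w ∈ graphBall G c L, FootBox flo fhi fw du (fineSkel φ c Af nL hL vα vβ c0f c1f (Df / 2) (Df / 2) Df w) → ψc w ∈ Pl)
    (hMfoot : ∀ w ∈ graphBall G c L, fineSkel φ c Af nL hL vα vβ c0f c1f (Df / 2) (Df / 2) Df w ∈ Finset.Icc LLO LHI → w ∈ MM)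
    {S : Finset V} (hcS : c ∈ S) (hSconn : ∀ s ∈ S, PathIn G (↑S : Set V) c s) (hSD : S ⊆ D) {ρ : ℕ} (hSρ : ∀ s ∈ S, s ∈ graphBall G c ρ)
    (hρL : ρ ≤ L) {kb : ℕ} (hSφ : ∀ s ∈ S, |φ s 0 - φ c 0| ≤ kb)
    (B : BridgePrm) (hB : BridgeOK B) {kq : ℕ} (hκL : hL.natAbs ≤ kq * nL) (ℓ' R's qB Nr Rl : ℕ) {σT vL : ℤ} (hσT : σT = 1 ∨ σT = -1)
    (hvL : |vL| ≤ nL) (hlay : (nL + hL.natAbs : ℕ) ≤ (nL : ℤ) * ℓ' + 1) (R'₃ qB₃ N₃ : ℕ)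
    {yL yT : Site 2} (cL cT : V) (hcLφ : φ cL = φ c + yL) (hcTφ : φ cT = φ c + yT) {RcL RcT : ℕ} (hcLπ : cL ∈ graphBall G c RcL)
    (hcTπ : cT ∈ graphBall G c RcT)
    (Rlev₁ N₁ j₀₁ j₁₁ Rlev₂ N₂ j₀₂ j₁₂ Rlev₃ N₃' j₀₃ j₁₃ : ℕ) (hRl₁ : Rlev₁ + 1 ≤ B.R') (hRl₂ : Rlev₂ + 1 ≤ R's) (hRl₃ : Rlev₃ + 1 ≤ R'₃)
    (hj₁ : j₁₁ ≤ Rlev₁) (hj₂ : j₁₂ ≤ Rlev₂) (hj₃ : j₁₃ ≤ Rlev₃)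
    (hB0 : Finset.Icc (pt nL (σh * hL)) (pt nL (σh * hL + ℓ')) ⊆ Finset.Icc B.B₀lo B.B₀hi) (hRlL : Rl ≤ L)
    -- near-`c` footprints READ BY THE TWO LATTICE FUNCTIONALS `Λ₀ = |vβΔ₀ − vαΔ₁|`, `Λ₁ = |nΔ₁ − hΔ₀|` (L-F2): the bridge region (σh-frame), the hop prism
    {Λ₀ Λ₁ : ℤ} (hΛR : ∀ x ∈ Finset.Icc B.regionLo B.regionHi, |vβ * (σh * x 0) - vα * x 1| ≤ Λ₀ ∧ |(nL : ℤ) * x 1 - hL * (σh * x 0)| ≤ Λ₁)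
    (hvα : |vα| ≤ nL) (hΛQ0 : modulus nL hL vα vβ + (nL : ℤ) * ((3 * ℓ' : ℕ) : ℤ) ≤ Λ₀) (hΛQ1 : (nL : ℤ) * ((3 * ℓ' : ℕ) : ℤ) ≤ Λ₁)
    (hnear : ∀ w, |vβ * (φ w 0 - φ c 0) - vα * (φ w 1 - φ c 1)| ≤ Λ₀ → |(nL : ℤ) * (φ w 1 - φ c 1) - hL * (φ w 0 - φ c 0)| ≤ Λ₁ →
      FootBox flo fhi fw du (fineSkel φ c Af nL hL vα vβ c0f c1f (Df / 2) (Df / 2) Df w))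
    {paLo pbLo paHi pbHi : ℕ → ℤ}
    (hreg : ∀ k ≤ Nr, (yRunSched hnL hvL hlay R's qB Nr).region k ⊆ Finset.Icc (pt (paLo k) (pbLo k)) (pt (paHi k) (pbHi k)))
    {PLO PHI : ℕ → Site 2}
    (hP0 : ∀ k ≤ Nr, PLO k 0 ≤ TwoAxis.Para.coarse c0f (Df / 2) Df (TwoAxis.Para.lam0 Af vα vβ yL) +
      (c0f * (Af * (modulus nL hL vα vβ * (min (σ * pbLo k) (σ * pbHi k)) -
        max (vα * ((shearUnit nL hL : ℤ) * (min (σ * paLo k) (σ * paHi k) - 1))) (vα * ((shearUnit nL hL : ℤ) * (max (σ * paLo k) (σ * paHi k)) + shearUnit nL hL - 1))) / nL)) / Df)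
    (hP1 : ∀ k ≤ Nr, TwoAxis.Para.coarse c0f (Df / 2) Df (TwoAxis.Para.lam0 Af vα vβ yL) +
      (c0f * (Af * (modulus nL hL vα vβ * (max (σ * pbLo k) (σ * pbHi k)) -
        min (vα * ((shearUnit nL hL : ℤ) * (min (σ * paLo k) (σ * paHi k) - 1))) (vα * ((shearUnit nL hL : ℤ) * (max (σ * paLo k) (σ * paHi k)) + shearUnit nL hL - 1))) / nL)) / Df
        + 1 ≤ PHI k 0)
    (hP2 : ∀ k ≤ Nr, PLO k 1 ≤ TwoAxis.Para.coarse c1f (Df / 2) Df (TwoAxis.Para.lam1 Af nL hL yL) + (c1f * (Af * ((shearUnit nL hL : ℤ) * (min (σ * paLo k) (σ * paHi k) - 1)))) / Df)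
    (hP3 : ∀ k ≤ Nr, TwoAxis.Para.coarse c1f (Df / 2) Df (TwoAxis.Para.lam1 Af nL hL yL) +
      (c1f * (Af * ((shearUnit nL hL : ℤ) * (max (σ * paLo k) (σ * paHi k)) + shearUnit nL hL - 1))) / Df + 1 ≤ PHI k 1)
    (hPf₁ : ∀ k ≤ Nr, sgOf du = 1 → flo ≤ PLO k du.1 ∧ PHI k du.1 ≤ fhi) (hPf₂ : ∀ k ≤ Nr, sgOf du = -1 → flo ≤ -PHI k du.1 ∧ -PLO k du.1 ≤ fhi)
    (hPf₃ : ∀ k ≤ Nr, -fw ≤ PLO k (oth du.1) ∧ PHI k (oth du.1) ≤ fw)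
    {yaLo ybLo yaHi ybHi : ℕ → ℤ} {laLo lbLo laHi lbHi : ℤ}
    (hregY : ∀ k ≤ N₃, (xRunSched nL ℓ' hL R'₃ qB₃ N₃).region k ⊆ Finset.Icc (pt (yaLo k) (ybLo k)) (pt (yaHi k) (ybHi k)))
    (hlastc : (xRunSched nL ℓ' hL R'₃ qB₃ N₃).core (N₃ + 1) ⊆ Finset.Icc (pt laLo lbLo) (pt laHi lbHi))
    {YLO YHI : ℕ → Site 2}
    (hY0 : ∀ k ≤ N₃, YLO k 0 ≤ TwoAxis.Para.coarse c0f (Df / 2) Df (TwoAxis.Para.lam0 Af vα vβ yT) +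
      (c0f * (Af * (modulus nL hL vα vβ * (min (σT * yaLo k) (σT * yaHi k)) -
        max (vα * ((shearUnit nL hL : ℤ) * (min (σT * ybLo k) (σT * ybHi k) - 1))) (vα * ((shearUnit nL hL : ℤ) * (max (σT * ybLo k) (σT * ybHi k)) + shearUnit nL hL - 1))) / nL)) / Df)
    (hY1 : ∀ k ≤ N₃, TwoAxis.Para.coarse c0f (Df / 2) Df (TwoAxis.Para.lam0 Af vα vβ yT) +
      (c0f * (Af * (modulus nL hL vα vβ * (max (σT * yaLo k) (σT * yaHi k)) -
        min (vα * ((shearUnit nL hL : ℤ) * (min (σT * ybLo k) (σT * ybHi k) - 1))) (vα * ((shearUnit nL hL : ℤ) * (max (σT * ybLo k) (σT * ybHi k)) + shearUnit nL hL - 1))) / nL)) / Df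
        + 1 ≤ YHI k 0)
    (hY2 : ∀ k ≤ N₃, YLO k 1 ≤ TwoAxis.Para.coarse c1f (Df / 2) Df (TwoAxis.Para.lam1 Af nL hL yT) + (c1f * (Af * ((shearUnit nL hL : ℤ) * (min (σT * ybLo k) (σT * ybHi k) - 1)))) / Df)
    (hY3 : ∀ k ≤ N₃, TwoAxis.Para.coarse c1f (Df / 2) Df (TwoAxis.Para.lam1 Af nL hL yT) +
      (c1f * (Af * ((shearUnit nL hL : ℤ) * (max (σT * ybLo k) (σT * ybHi k)) + shearUnit nL hL - 1))) / Df + 1 ≤ YHI k 1)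
    (hYf₁ : ∀ k ≤ N₃, sgOf du = 1 → flo ≤ YLO k du.1 ∧ YHI k du.1 ≤ fhi) (hYf₂ : ∀ k ≤ N₃, sgOf du = -1 → flo ≤ -YHI k du.1 ∧ -YLO k du.1 ≤ fhi)
    (hYf₃ : ∀ k ≤ N₃, -fw ≤ YLO k (oth du.1) ∧ YHI k (oth du.1) ≤ fw)
    (hL0 : LLO 0 ≤ TwoAxis.Para.coarse c0f (Df / 2) Df (TwoAxis.Para.lam0 Af vα vβ yT) +
      (c0f * (Af * (modulus nL hL vα vβ * (min (σT * laLo) (σT * laHi)) -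
        max (vα * ((shearUnit nL hL : ℤ) * (min (σT * lbLo) (σT * lbHi) - 1))) (vα * ((shearUnit nL hL : ℤ) * (max (σT * lbLo) (σT * lbHi)) + shearUnit nL hL - 1))) / nL)) / Df)
    (hL1 : TwoAxis.Para.coarse c0f (Df / 2) Df (TwoAxis.Para.lam0 Af vα vβ yT) +
      (c0f * (Af * (modulus nL hL vα vβ * (max (σT * laLo) (σT * laHi)) -
        min (vα * ((shearUnit nL hL : ℤ) * (min (σT * lbLo) (σT * lbHi) - 1))) (vα * ((shearUnit nL hL : ℤ) * (max (σT * lbLo) (σT * lbHi)) + shearUnit nL hL - 1))) / nL)) / Df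
        + 1 ≤ LHI 0)
    (hL2 : LLO 1 ≤ TwoAxis.Para.coarse c1f (Df / 2) Df (TwoAxis.Para.lam1 Af nL hL yT) + (c1f * (Af * ((shearUnit nL hL : ℤ) * (min (σT * lbLo) (σT * lbHi) - 1)))) / Df)
    (hL3 : TwoAxis.Para.coarse c1f (Df / 2) Df (TwoAxis.Para.lam1 Af nL hL yT) +
      (c1f * (Af * ((shearUnit nL hL : ℤ) * (max (σT * lbLo) (σT * lbHi)) + shearUnit nL hL - 1))) / Df + 1 ≤ LHI 1)
    (hxa : ∀ x ∈ Finset.Icc B.core1Lo B.core1Hi,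
      -((((nL : ℤ) + vL).toNat : ℕ) : ℤ) ≤ σ * σh * x 0 - σ * yL 0 ∧ σ * σh * x 0 - σ * yL 0 ≤ ((((nL : ℤ) - vL).toNat : ℕ) : ℤ))
    (hxb : ∀ x ∈ Finset.Icc B.core1Lo B.core1Hi,
      |σ * ((nL : ℤ) * (x 1 - yL 1) - hL * (σh * x 0 - yL 0))| + shearUnit nL hL ≤ ((qB : ℤ) + 1) * shearUnit nL hL)
    (hxy : ∀ a s : ℤ, (yPrmW nL ℓ' hL vL R's qB Nr).aLo (Nr + 1) ≤ s / (shearUnit nL hL : ℤ) →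
      s / (shearUnit nL hL : ℤ) ≤ (yPrmW nL ℓ' hL vL R's qB Nr).aHi (Nr + 1) →
      (yPrmW nL ℓ' hL vL R's qB Nr).bLo (Nr + 1) ≤ a → a ≤ (yPrmW nL ℓ' hL vL R's qB Nr).bHi (Nr + 1) →
      (xPrmW nL ℓ' hL R'₃ qB₃ N₃).InCore 0 (σT * σ * a - σT * (yT - yL) 0)
        ((σT * σ * s - σT * ((nL : ℤ) * (yT - yL) 1 - hL * (yT - yL) 0)) / (shearUnit nL hL : ℤ)))
    -- seed clearances: the bridge segment's α-floor; the two bands in the SERVED form (discharge: `clear_alongY_of_floors` / `clear_tanX_of_level` below)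
    (hclr₁ : (kb : ℤ) < B.B₀lo 0 - B.R' - B.pr)
    (hclear₂ : ∀ k ≤ Nr, ∀ w ∈ graphBall G c L, runY φ cL nL hL σ w ∈ (yRunSched hnL hvL hlay R's qB Nr).region k → w ∉ S)
    (hclear₃ : ∀ k ≤ N₃, ∀ w ∈ graphBall G c L, runX φ cT nL hL σT w ∈ (xRunSched nL ℓ' hL R'₃ qB₃ N₃).region k → w ∉ S)
    (hπ1 : (B.core1Lo 0).natAbs + (B.core1Lo 1).natAbs ≤ L)
    (hπ2 : ∀ k ≤ Nr, RcL + (((((k + 1 : ℕ) : ℤ) * vL).natAbs +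
      (((shearUnit nL hL : ℤ) * |((k + 1 : ℕ) : ℤ) * (yPrmW nL ℓ' hL vL R's qB Nr).sLo| + |hL| * |((k + 1 : ℕ) : ℤ) * vL| + shearUnit nL hL) / nL).natAbs + 1)) ≤ L)
    (hπ3 : RcT + (N₃ + 1) * shearUnit nL hL ≤ L)
    {S₀ : Finset V} (hS₀ : S₀ ⊆ S) (hSU : S ⊆ pgramPrismFin G φ c nL hL (3 * ℓ') Rl) {Δ' : ℕ} {δ ε η : ℝ} (hδ : 0 < δ)
    (hlink : 1 - δ < (bondPercolation G q).real (linkIn (↑(pgramPrismFin G φ c nL hL (3 * ℓ') Rl) : Set V) S₀ (pgSideHalfW G φ c nL hL ℓ' Rl σh 1)))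
    (hchain : ∀ (W : Sym2 V → unitInterval) (s : Fin (0 + 1 + Nr + 1 + N₃ + 1) → TStep (winGraph G c L))
      (T' : Fin (0 + 1 + Nr + 1 + N₃ + 1) → Finset V) (η : ℝ),
      (∀ i, (s i).L.o = (s 0).L.o) →
      (∀ i : Fin (0 + 1 + Nr + 1 + N₃), T' (Fin.castSucc i) ⊆ (s i.succ).L.X 0) →
      (∀ i, T' i ⊆ (s i).T) →
      (∀ i, (s i).KitsAtF W q Δ' δ) →
      η ≤ δ / 2 →
      (∀ i, (prodBernoulli W).real (⋃ t ∈ (s i).T \ T' i, openConn (s 0).L.o t) ≤ η) →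
      1 - δ < (prodBernoulli W).real (s 0).L.reachB →
        1 - ε < (prodBernoulli W).real (⋃ t ∈ T' (Fin.last (0 + 1 + Nr + 1 + N₃)), openConn (s 0).L.o t))
    (hcount₁ : 1 / (1 - (q : ℝ)) ^ (Δ' * N₁) ≤ δ * ((Finset.Icc j₀₁ j₁₁).card : ℝ))
    (hcount₂ : 1 / (1 - (q : ℝ)) ^ (Δ' * N₂) ≤ δ * ((Finset.Icc j₀₂ j₁₂).card : ℝ))
    (hcount₃ : 1 / (1 - (q : ℝ)) ^ (Δ' * N₃') ≤ δ * ((Finset.Icc j₀₃ j₁₃).card : ℝ))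
    (hη : η ≤ δ / 2)
    (Pb Pr : ApronPrm) {Mz Rs KCmaxb KCmaxr rsb rsr cSb cSr cU r₁ r₂ Rb : ℕ}
    (hPNb : 1 ≤ Pb.N) (hAb : Pb.A = (Mz : ℤ) + 2)
    (hdDb : Pb.d + 2 ≤ shellD Pb) (hDρb : Rs + 1 ≤ shellD Pb) (hKCmaxb : shellD Pb + Mz + 1 ≤ KCmaxb)
    (hwideb : ∀ j, j₀₁ ≤ j → j ≤ j₁₁ → ∀ i, (B.B₀lo - (j : Site 2)) i + 2 * tanOff Pb.ℓs Pb.M ≤ (B.B₀hi + (j : Site 2)) i)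
    (hdwb : ∀ j, j₀₁ ≤ j → j ≤ j₁₁ → ∀ i, (B.B₀lo - (j : Site 2)) i + (Pb.d + 2 : ℕ) ≤ (B.B₀hi + (j : Site 2)) i)
    (hDwb : ∀ j, j₀₁ ≤ j → j ≤ j₁₁ → ∀ i, (B.B₀lo - (j : Site 2)) i + ((shellD Pb + 1 + Pb.d + KCmaxb + Rs : ℕ) : ℤ) ≤ (B.B₀hi + (j : Site 2)) i)
    (hT'b : (shellD Pb : ℤ) + KCmaxb + Rs ≤ tanOff Pb.ℓs Pb.M)
    (hr₀b : Pb.N * (tanOff Pb.ℓs Pb.M + 2) + Pb.N * Pb.d + (KCmaxb + Rs) ≤ Pb.r₀) (hRb₀ : Pb.r₀ ≤ L)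
    (hrsb : 1 + (Pb.N * (tanOff Pb.ℓs Pb.M + 2) + Pb.N * Pb.d + (KCmaxb + Rs)) ≤ rsb)
    (hcSb : (Pb.N + 1) * (tanOff Pb.ℓs Pb.M + 1) + (Pb.N + 1) * Pb.d + (KCmaxb + 1) + cU ≤ cSb)
    (hEb : j₁₁ + (Pb.N * (tanOff Pb.ℓs Pb.M + 1) + Pb.N * Pb.d + KCmaxb) ≤ B.R')
    (hreachb : r₁ + (Pb.N * (tanOff Pb.ℓs Pb.M + 1) + Pb.N * Pb.d + KCmaxb) ≤ Pb.r₀) (hr₁ : Rb ≤ r₁) (hr₁R : r₁ ≤ L)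
    (hPNr : kq + 3 ≤ Pr.N) (hAr : Pr.A = (Mz + 1 : ℕ) * (shearUnit nL hL : ℤ) + 1)
    (hdDr : Pr.d + 2 ≤ shellD Pr) (hDρr : Rs + 1 ≤ shellD Pr) (hKCmaxr : (shellD Pr + Mz + 1) * (kq + 1) ≤ KCmaxr)
    (hwider : ∀ k ≤ Nr, ∀ j, j₀₂ ≤ j → j ≤ j₁₂ → ∀ i, ((yRunSched hnL hvL hlay R's qB Nr).lo k - (j : Site 2)) i + 2 * tanOff Pr.ℓs Pr.M ≤
      ((yRunSched hnL hvL hlay R's qB Nr).hi k + (j : Site 2)) i)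
    (hdwr : ∀ k ≤ Nr, ∀ j, j₀₂ ≤ j → j ≤ j₁₂ → ∀ i, ((yRunSched hnL hvL hlay R's qB Nr).lo k - (j : Site 2)) i + (Pr.d + 2 : ℕ) ≤
      ((yRunSched hnL hvL hlay R's qB Nr).hi k + (j : Site 2)) i)
    (hDwr : ∀ k ≤ Nr, ∀ j, j₀₂ ≤ j → j ≤ j₁₂ → ∀ i, ((yRunSched hnL hvL hlay R's qB Nr).lo k - (j : Site 2)) i + ((shellD Pr + 1 + Pr.d + KCmaxr + Rs : ℕ) : ℤ) ≤
      ((yRunSched hnL hvL hlay R's qB Nr).hi k + (j : Site 2)) i)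
    (hwidey : ∀ k ≤ N₃, ∀ j, j₀₃ ≤ j → j ≤ j₁₃ → ∀ i, ((xRunSched nL ℓ' hL R'₃ qB₃ N₃).lo k - (j : Site 2)) i + 2 * tanOff Pr.ℓs Pr.M ≤
      ((xRunSched nL ℓ' hL R'₃ qB₃ N₃).hi k + (j : Site 2)) i)
    (hdwy : ∀ k ≤ N₃, ∀ j, j₀₃ ≤ j → j ≤ j₁₃ → ∀ i, ((xRunSched nL ℓ' hL R'₃ qB₃ N₃).lo k - (j : Site 2)) i + (Pr.d + 2 : ℕ) ≤
      ((xRunSched nL ℓ' hL R'₃ qB₃ N₃).hi k + (j : Site 2)) i)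
    (hDwy : ∀ k ≤ N₃, ∀ j, j₀₃ ≤ j → j ≤ j₁₃ → ∀ i, ((xRunSched nL ℓ' hL R'₃ qB₃ N₃).lo k - (j : Site 2)) i + ((shellD Pr + 1 + Pr.d + KCmaxr + Rs : ℕ) : ℤ) ≤
      ((xRunSched nL ℓ' hL R'₃ qB₃ N₃).hi k + (j : Site 2)) i)
    (hT'r : (shellD Pr : ℤ) + KCmaxr + Rs ≤ tanOff Pr.ℓs Pr.M)
    (hr₀r : Pr.N * (tanOff Pr.ℓs Pr.M + 2) + Pr.N * Pr.d + (KCmaxr + Rs) ≤ Pr.r₀) (hRr₀ : Pr.r₀ ≤ L)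
    (hrsr : 1 + (Pr.N * (tanOff Pr.ℓs Pr.M + 2) + Pr.N * Pr.d + (KCmaxr + Rs)) ≤ rsr)
    (hcSr : (Pr.N + 1) * (tanOff Pr.ℓs Pr.M + 1) + (Pr.N + 1) * Pr.d + (KCmaxr + 1) + cU ≤ cSr)
    (hEr : j₁₂ + (Pr.N * (tanOff Pr.ℓs Pr.M + 1) + Pr.N * Pr.d + KCmaxr) ≤ R's)
    (hEy : j₁₃ + (Pr.N * (tanOff Pr.ℓs Pr.M + 1) + Pr.N * Pr.d + KCmaxr) ≤ R'₃)
    (hreachr : r₂ + (Pr.N * (tanOff Pr.ℓs Pr.M + 1) + Pr.N * Pr.d + KCmaxr) ≤ Pr.r₀) (hr₂ : Rl ≤ r₂) (hr₂R : r₂ ≤ L)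
    -- the short region and the zone datum at the kit centres (inside `Rg`, connected from the centre inside itself, containing the centre and the
    -- fat-prism zone box of record `cylBallFin c kz Rk`, `Rk ≥ cylRadMax types kz (2·KCmax)` of both kits)
    (Rg : V → Finset V) (hRg : ∀ c', ∀ u ∈ Rg c', u ∈ graphBall G c' Rs) (hRgcard : ∀ c', (Rg c').card ≤ cU) (hcU1 : 1 ≤ cU)
    (Λc : V → ℕ → Finset V) (kz : ℕ) (hΛRg : ∀ c', Λc c' kz ⊆ Rg c') (hzconn : ∀ c', ∀ s ∈ Λc c' kz, PathIn G (↑(Λc c' kz) : Set V) c' s)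
    (hcz : ∀ c', c' ∈ Λc c' kz) {Rk : ℕ} (hkz : 1 ≤ kz) (hRkb : cylRadMax G φ types kz (2 * KCmaxb) ≤ Rk)
    (hRkr : cylRadMax G φ types kz (2 * KCmaxr) ≤ Rk) (hΛcyl : ∀ c', cylBallFin G φ c' kz Rk ⊆ Λc c' kz)
    (hclrz : (Mz + 4) * (nL + hL.natAbs) ≤ nL * (ℓ' + 1))
    (Qb Fb : V → Finset V)
    (hQb : ∀ c', ∀ w ∈ Qb c', w ∈ graphBall G c' Rb ∧
      rootFrame φ c σh w ∈ Finset.Icc (rootFrame φ c σh c' - ((B.pr : ℕ) : Site 2)) (rootFrame φ c σh c' + ((B.pr : ℕ) : Site 2)))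
    (hFb : ∀ c', ∀ w ∈ Fb c', w ∈ Qb c' ∧ rootFrame φ c σh w ∈ Finset.Icc (rootFrame φ c σh c' + B.dlo) (rootFrame φ c σh c' + B.dhi))
    (kk₁ kk₂ kk₃ : ℕ) (hkN₁ : kk₁ * (Δg + 1) ^ (2 * rsb) ≤ N₁) (hkN₂ : kk₂ * (Δg + 1) ^ (2 * rsr) ≤ N₂) (hkN₃ : kk₃ * (Δg + 1) ^ (2 * rsr) ≤ N₃')
    (hk₁ : (1 - (q : ℝ) ^ (1 + Δg * cSb + cSb * cU)) ^ kk₁ ≤ δ) (hk₂ : (1 - (q : ℝ) ^ (1 + Δg * cSr + cSr * cU)) ^ kk₂ ≤ δ)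
    (hk₃ : (1 - (q : ℝ) ^ (1 + Δg * cSr + cSr * cU)) ^ kk₃ ≤ δ)
    (hbridge : ∀ c', 1 - δ ^ 3 < (bondPercolation G q).real (linkIn (↑(Qb c') : Set V) (Λc c' kz) (Fb c')))
    (hlongx : ∀ c' (τ : ℤ), τ = 1 ∨ τ = -1 → 1 - δ ^ 3 < (bondPercolation G q).real
      (linkIn (pgramPrism G φ c' nL hL (3 * ℓ') Rl) (Λc c' kz) (pgSideHalfW G φ c' nL hL ℓ' Rl σT (σT * τ))))
    (hlongy : ∀ c' (τ : ℤ), τ = 1 ∨ τ = -1 → 1 - δ ^ 3 < (bondPercolation G q).real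
      (linkIn (pgramPrism G φ c' nL hL (3 * ℓ') Rl) (Λc c' kz) (pgTopPieceW G φ c' nL hL ℓ' Rl σ τ vL)))
    {m : ℕ} (hDm : ∀ d ∈ D, ∀ d' ∈ D, φ d - φ d' ∈ box 2 m)
    {R₁ : ℕ}
    (hR₁ : ∀ (c' : V) (R' : ℕ), R₁ ≤ R' → ∀ (Rw : ℕ) (D' B' : Finset V), (∀ d ∈ D', d ∈ graphBall G c' Rw) →
      (∀ d ∈ D', ∀ d' ∈ D', φ d - φ d' ∈ box 2 m) → B' ⊆ D' → (∀ a ∈ B', a ∈ graphBall G c' ρ) →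
        (bondPercolation G q).real (excess G c' R' D' B') ≤ η)
    (hR₁b : R₁ ≤ L - Pb.r₀) (hR₁r : R₁ ≤ L - Pr.r₀) :
    ∃ Qt Ft : Finset V, Ft ⊆ T ∧ Qt ⊆ D ∧ Disjoint Ft Z ∧ 1 - ε < (prodBernoulli Wt).real (linkIn (↑Qt : Set V) S Ft) := by
  set FS := fineSkel φ c Af nL hL vα vβ c0f c1f (Df / 2) (Df / 2) Df with hFS
  set SN := yRunSched hnL hvL hlay R's qB Nr with hSN
  set SY := xRunSched nL ℓ' hL R'₃ qB₃ N₃ with hSY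
  have hσhabs : |σh| = 1 := by rcases hσh with h | h <;> simp [h]
  have hσhsq : σh * σh = 1 := by rcases hσh with rfl | rfl <;> simp
  have hσhσh : ∀ z : ℤ, σh * (σh * z) = z := fun z => by rw [← mul_assoc, hσhsq, one_mul]
  obtain ⟨he0, he1⟩ := fineSkel_of_φ_eq (φ := φ) c (Af := Af) (nL := nL) (hL := hL) (vα := vα) (vβ := vβ) (c0f := c0f) (c1f := c1f) (Df := Df) hcLφ
  obtain ⟨hf0, hf1⟩ := fineSkel_of_φ_eq (φ := φ) c (Af := Af) (nL := nL) (hL := hL) (vα := vα) (vβ := vβ) (c0f := c0f) (c1f := c1f) (Df := Df) hcTφ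
  -- the inner ball inside the outer ball
  have hball : ∀ {w : V}, w ∈ graphBall G c L → w ∈ graphBall G w₀ Rπ := by
    intro w hw
    have h2 := BoxProdZ2.mem_graphBall_add G hcL hw
    rwa [Nat.sub_add_cancel hLπ] at h2
  -- (1) near-`c` footprints by the two lattice functionals ((L-F2), as `faceRoute_of_numbers6_x`): the bridge region and the hop prism
  have hfoot₁ : ∀ w ∈ graphBall G c L, rootFrame φ c σh w ∈ Finset.Icc B.regionLo B.regionHi → ψc w ∈ Pl := fun w hw hw' => by
    obtain ⟨h0, h1⟩ := hΛR _ hw'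
    simp only [rootFrame_apply_zero, rootFrame_apply_one, hσhσh] at h0 h1
    exact hPlfoot w hw (hnear w h0 h1)
  have hQL : ∀ w ∈ pgramPrismFin G φ c nL hL (3 * ℓ') Rl, w ∈ graphBall G c L := fun w hw =>
    graphBall_mono G c hRlL (pgramPrism_subset_graphBall c nL hL (3 * ℓ') Rl ((mem_pgramPrismFin G φ).1 hw))
  have hQfoot : ∀ w ∈ pgramPrismFin G φ c nL hL (3 * ℓ') Rl, ψc w ∈ Pl := fun w hw => by
    obtain ⟨h0, h1⟩ := lam_bounds_of_mem_pgramCyl (φ := φ) hnL hvα hmf ((mem_pgramPrism G φ).1 ((mem_pgramPrismFin G φ).1 hw)).2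
    exact hPlfoot w (hQL w hw) (hnear w (h0.trans hΛQ0) (h1.trans hΛQ1))
  have hUD : pgramPrismFin G φ c nL hL (3 * ℓ') Rl ⊆ D := fun w hw =>
    hPlD ((mem_Win G ψc).2 ⟨hball (hQL w hw), hQfoot w hw⟩)
  -- (2) the hop's landing inside core `0` of the bridge
  have hT₀ : ∀ w ∈ pgSideHalfW G φ c nL hL ℓ' Rl σh 1, w ∈ graphBall G c L ∧ rootFrame φ c σh w ∈ Finset.Icc B.B₀lo B.B₀hi := fun w hw => by
    refine ⟨hQL w ((mem_pgramPrismFin G φ).2 (coe_pgSideHalfW_subset (G := G) (φ := φ) c nL hL ℓ' Rl σh 1 (Finset.mem_coe.2 hw))), hB0 ?_⟩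
    have hb := rootFrame_mem_box_of_sideHalf_same c hσh hnL (h := hL) (ℓ := ℓ') (R := Rl) (τ := 1) (Or.inl rfl) hw
    rw [rootFrame_self, zero_add, zero_add, one_mul, min_eq_left (by positivity : (0 : ℤ) ≤ ℓ'), max_eq_right (by positivity : (0 : ℤ) ≤ ℓ'), add_zero] at hb
    exact hb
  -- (3) the along y′-run's regions
  have hreadP : ∀ k ≤ Nr, ∀ w, runY φ cL nL hL σ w ∈ SN.region k → FootBox flo fhi fw du (FS w) := fun k hk w hw => by
    have hw' := runY_sign_mem_Icc cL hnL hL hσ (hreg k hk hw)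
    refine footBox_of_runX_mem_Icc c hAf hnL hmf hc0 hc1 hDf cL (LO := PLO k) (HI := PHI k) ?_ ?_ ?_ ?_ (hPf₁ k hk) (hPf₂ k hk) (hPf₃ k hk) hw'
    · rw [he0]; simpa only [pt_zero, pt_one] using hP0 k hk
    · rw [he0]; simpa only [pt_zero, pt_one] using hP1 k hk
    · rw [he1]; simpa only [pt_zero, pt_one] using hP2 k hk
    · rw [he1]; simpa only [pt_zero, pt_one] using hP3 k hk
  have hfoot₂ : ∀ k ≤ Nr, ∀ w ∈ graphBall G c L, runY φ cL nL hL σ w ∈ SN.region k → ψc w ∈ Pl :=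
    fun k hk w hw hw' => hPlfoot w hw (hreadP k hk w hw')
  -- (3′) the tangential x-run's regions and last core
  have hreadY : ∀ k ≤ N₃, ∀ w, runX φ cT nL hL σT w ∈ SY.region k → FootBox flo fhi fw du (FS w) := fun k hk w hw => by
    have hw' := runX_sign_mem_Icc cT hnL hL hσT (hregY k hk hw)
    refine footBox_of_runX_mem_Icc c hAf hnL hmf hc0 hc1 hDf cT (LO := YLO k) (HI := YHI k) ?_ ?_ ?_ ?_ (hYf₁ k hk) (hYf₂ k hk) (hYf₃ k hk) hw'
    · rw [hf0]; simpa only [pt_zero, pt_one] using hY0 k hk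
    · rw [hf0]; simpa only [pt_zero, pt_one] using hY1 k hk
    · rw [hf1]; simpa only [pt_zero, pt_one] using hY2 k hk
    · rw [hf1]; simpa only [pt_zero, pt_one] using hY3 k hk
  have hfoot₃ : ∀ k ≤ N₃, ∀ w ∈ graphBall G c L, runX φ cT nL hL σT w ∈ SY.region k → ψc w ∈ Pl :=
    fun k hk w hw hw' => hPlfoot w hw (hreadY k hk w hw')
  have hlastf : ∀ w ∈ graphBall G c L, runX φ cT nL hL σT w ∈ SY.core (N₃ + 1) → w ∈ MM := fun w hw hw' => by
    have hw'' := runX_sign_mem_Icc cT hnL hL hσT (hlastc hw')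
    refine hMfoot w hw (fine_mem_Icc_of_runX_mem_Icc_signed c hAf hnL hmf hc0 hc1 hDf cT (LO := LLO) (HI := LHI) ?_ ?_ ?_ ?_ hw'')
    · rw [hf0]; simpa only [pt_zero, pt_one] using hL0
    · rw [hf0]; simpa only [pt_zero, pt_one] using hL1
    · rw [hf1]; simpa only [pt_zero, pt_one] using hL2
    · rw [hf1]; simpa only [pt_zero, pt_one] using hL3
  -- (4) the bridge segment's seed reading
  have hSk : ∀ a ∈ S, |rootFrame φ c σh a 0| ≤ kb := fun a ha => by
    rw [rootFrame_apply_zero, abs_mul, hσhabs, one_mul]; exact hSφ a ha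
  -- (5) the cross links
  have hx₁₂ : ∀ w ∈ graphBall G c L, rootFrame φ c σh w ∈ Finset.Icc B.core1Lo B.core1Hi → runY φ cL nL hL σ w ∈ SN.core 0 :=
    runY_core_zero_of_bridge_core' (G := G) hnL hvL hlay R's qB Nr c cL hcLφ σ hσh L hxa hxb
  have hcT' : φ cT = φ cL + (yT - yL) := by rw [hcTφ, hcLφ, add_assoc, add_sub_cancel]
  have hx₂₃ : ∀ w ∈ graphBall G c L, runY φ cL nL hL σ w ∈ SN.core (Nr + 1) → runX φ cT nL hL σT w ∈ SY.core 0 :=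
    fun w _ hw => runX_core_zero_of_runY_core hnL hσ hvL hlay R'₃ qB₃ N₃ hcT' hxy hw
  -- (6) nonempty targets
  have hTne₁ : (Win G (rootFrame φ c σh) c (Finset.Icc B.core1Lo B.core1Hi) L).Nonempty := by
    obtain ⟨g, hg, hφg⟩ := exists_mem_graphBall_φ_eq hstep c (φ c + pt (σh * B.core1Lo 0) (B.core1Lo 1))
    refine ⟨g, (mem_Win G _).2 ⟨graphBall_mono G c ?_ hg, ?_⟩⟩
    · simp only [Pi.add_apply, pt_zero, pt_one, add_sub_cancel_left]
      rw [Int.natAbs_mul, show σh.natAbs = 1 by rcases hσh with h | h <;> simp [h], one_mul]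
      exact hπ1
    · have h0 : rootFrame φ c σh g 0 = B.core1Lo 0 := by
        rw [rootFrame_apply_zero, hφg, Pi.add_apply, pt_zero]; rw [show φ c 0 + σh * B.core1Lo 0 - φ c 0 = σh * B.core1Lo 0 by ring, ← mul_assoc, hσhsq, one_mul]
      have h1 : rootFrame φ c σh g 1 = B.core1Lo 1 := by
        rw [rootFrame_apply_one, hφg, Pi.add_apply, pt_one]; ring
      have hg' : rootFrame φ c σh g = B.core1Lo := by funext i; fin_cases i <;> assumption
      rw [hg']
      exact Finset.mem_Icc.2 ⟨le_rfl, BridgePrm.core1Lo_le_core1Hi hB⟩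
  have hTne₂ : ∀ k ≤ Nr, (Win G (runY φ cL nL hL σ) c (SN.core (k + 1)) L).Nonempty := by
    intro k hk
    obtain ⟨g, hg, hφg⟩ := exists_mem_graphBall_runY_eq hstep hnL cL hL hσ
      (pt (((k + 1 : ℕ) : ℤ) * (yPrmW nL ℓ' hL vL R's qB Nr).sLo) (((k + 1 : ℕ) : ℤ) * vL))
    refine ⟨g, (mem_Win G _).2 ⟨?_, ?_⟩⟩
    · have h := BoxProdZ2.mem_graphBall_add G hcLπ hg
      refine graphBall_mono G c ?_ h
      have := hπ2 k hk
      simpa only [pt_zero, pt_one] using this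
    · rw [hSN, yRunSched, mem_scheduleN_core_iff (yPrmW_ok hnL hvL hlay R's qB Nr) (yPrmW_eb nL ℓ' hL vL R's qB Nr), hφg, pt_zero, pt_one]
      have hnom := RunPrm.inCore_nominal (yPrmW_ok hnL hvL hlay R's qB Nr) (k + 1)
      have hd : ((yPrmW nL ℓ' hL vL R's qB Nr).d : ℤ) = vL := rfl
      rw [hd] at hnom
      simpa only [Nat.cast_add, Nat.cast_one] using hnom
  have hTne₃ : ∀ k ≤ N₃, (Win G (runX φ cT nL hL σT) c (SY.core (k + 1)) L).Nonempty := by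
    intro k hk
    have hσTsq : σT * σT = 1 := by rcases hσT with rfl | rfl <;> simp
    obtain ⟨g, hg, hφg⟩ := exists_mem_graphBall_φ_eq hstep cT (φ cT + pt (σT * (((k + 1 : ℕ) : ℤ) * nL)) (σT * (((k + 1 : ℕ) : ℤ) * hL)))
    refine ⟨g, (mem_Win G _).2 ⟨?_, ?_⟩⟩
    · have hg' : g ∈ graphBall G cT ((k + 1) * shearUnit nL hL) := by
        refine graphBall_mono G cT (le_of_eq ?_) hg
        simp only [Pi.add_apply, pt_zero, pt_one, add_sub_cancel_left, Int.natAbs_mul, show σT.natAbs = 1 by rcases hσT with h | h <;> simp [h], one_mul,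
          Int.natAbs_natCast]
        unfold shearUnit; ring
      have h := BoxProdZ2.mem_graphBall_add G hcTπ hg'
      refine graphBall_mono G c ?_ h
      have : (k + 1) * shearUnit nL hL ≤ (N₃ + 1) * shearUnit nL hL := Nat.mul_le_mul_right _ (by omega)
      omega
    · rw [hSY, xRunSched, mem_scheduleN_core_iff (xPrmW_ok nL ℓ' hL R'₃ qB₃ N₃) (xPrmW_eb nL ℓ' hL R'₃ qB₃ N₃)]
      have h0 : runX φ cT nL hL σT g 0 = ((k + 1 : ℕ) : ℤ) * nL := by
        rw [runX_zero, relCoord_apply, hφg, Pi.add_apply, pt_zero]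
        rw [show φ cT 0 + σT * (((k + 1 : ℕ) : ℤ) * ↑nL) - φ cT 0 = σT * (((k + 1 : ℕ) : ℤ) * ↑nL) by ring, ← mul_assoc, hσTsq, one_mul]
      have h1 : runX φ cT nL hL σT g 1 = 0 := by
        rw [runX_one, shearCoord_apply, hφg, Pi.add_apply, Pi.add_apply, pt_zero, pt_one]
        rw [show σT * (↑nL * (φ cT 1 + σT * (((k + 1 : ℕ) : ℤ) * hL) - φ cT 1) - hL * (φ cT 0 + σT * (((k + 1 : ℕ) : ℤ) * ↑nL) - φ cT 0)) = 0 by ring]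
        simp
      rw [h0, h1]
      have hnom := RunPrm.inCore_nominal (xPrmW_ok nL ℓ' hL R'₃ qB₃ N₃) (k + 1)
      have hs : ((xPrmW nL ℓ' hL R'₃ qB₃ N₃).sLo : ℤ) = nL := rfl
      have hd : ((xPrmW nL ℓ' hL R'₃ qB₃ N₃).d : ℤ) = 0 := rfl
      rw [hs, hd, mul_zero] at hnom
      exact hnom
  -- assemble
  exact faceRoute_of_inputs4_yF hlipφ hstep hfr hκ hΔg hWG hWD hDπ hcL hLπ hPlD hMT hMZ hcS hSconn hSD hSρ hρL hσh hσ hSk B hB hnL cL cT hL hκL ℓ' R's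
    qB Nr Rl hσT hvL hlay R'₃ qB₃ N₃ Rlev₁ N₁ j₀₁ j₁₁ Rlev₂ N₂ j₀₂ j₁₂ Rlev₃ N₃' j₀₃ j₁₃ hRl₁ hRl₂ hRl₃ hj₁ hj₂ hj₃ hfoot₁ hfoot₂ hfoot₃ hclr₁ hclear₂
    hclear₃ hTne₁ hTne₂ hTne₃ hx₁₂ hx₂₃ hlastf hUD hQL hS₀ hSU hT₀ hδ hlink hchain hcount₁ hcount₂ hcount₃ hη Pb Pr hPNb hAb hdDb hDρb hKCmaxb hwideb
    hdwb hDwb hT'b hr₀b hRb₀ hrsb hcSb hEb hreachb hr₁ hr₁R hPNr hAr hdDr hDρr hKCmaxr hwider hdwr hDwr hwidey hdwy hDwy hT'r hr₀r hRr₀ hrsr hcSr hEr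
    hEy hreachr hr₂ hr₂R Rg hRg hRgcard hcU1 Λc kz hΛRg hzconn hcz hkz hRkb hRkr hΛcyl hclrz Qb Fb hQb hFb kk₁ kk₂ kk₃ hkN₁ hkN₂ hkN₃ hk₁ hk₂ hk₃
    hbridge hlongx hlongy hDm hR₁ hR₁b hR₁r

end Skelφ

end Summit.CriticalPhenomena.PercolationContinuityZ3.Theorems.Transplant

end
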